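import Mathlib
import Summits.NavierStokesRegularity.NavierStokesRegularity.Theorems.SymmetryModuliCountStretchingCertificateComparisonKato
import Summits.NavierStokesRegularity.NavierStokesRegularity.Theorems.SymmetryModuliCountStretchingCertificateComparisonMaxPrinciple
import Summits.NavierStokesRegularity.NavierStokesRegularity.Theorems.SymmetryModuliCountStretchingCertificateComparisonWeighted
import Summits.NavierStokesRegularity.NavierStokesRegularity.Theorems.SqueezeCycleExtremalBiaxialitySubcriticalGaugeStrainBound
import Literature.Analysis.FluidPDE.TypeIAncientMild
import Literature.Analysis.FluidPDE.TypeIAncientMildClassical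
import Literature.Analysis.FluidPDE.ParabolicComparison
import HarnessLib

/-!
# Crux `RecurrentLiouville` (stmt-NavierStokesRegularity-1589), line `Sketch`: Constantin's window
# stretching inequality in the Type-I ancient mild class (stub `stub_clockConstantinWindow`)

For `v` in the Type-I ancient mild class `A_C` (`IsTypeIAncientMild C v`), a window
`t₀ < t₁ < 0` and a continuous `Λ : ℝ → ℝ` majorising the strain form on the window
(`⟪∇v(t,x)ξ, ξ⟫ ≤ Λ(t)‖ξ‖²` for `t ∈ [t₀, t₁]`), every bound `‖ω(t₀, ·)‖ ≤ A` of the vorticity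
`ω = curl v` propagates as `‖ω(t₁, x)‖ ≤ A exp(∫_{t₀}^{t₁} Λ)`.

## Proof (physical variables)

* **Kato for the square** (`clockWindow_F_subsolution`): `F = ‖ω‖²` satisfies
  `∂ₜF + v·∇F − ΔF ≤ 2Λ(t) F` on the window. At a point with `ω ≠ 0` this is the tree's
  `stretchCert_F_subsolution` (Constantin 1990, (2.9)) with the constant certificate `h ≡ 1` and,
  at the point `(t, x)`, `δ := 1 − (−t)Λ(t)`: the certificate inequality reads
  `(−t)(⟪∇v ξ, ξ⟫ − |∇ξ|²_F − Λ(t)) ≤ 0`, true since `ξ` is a unit vector; the vorticity equation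
  is `vorticity_eq_deriv_of_typeI`. At a zero of `ω` the smooth nonnegative `F` has a space–time
  minimum (`∇F = 0`, `∂ₜF = 0`, `ΔF ≥ 0`).
* **The weight** `w(t) = exp(−2∫_{t₀}^{t} Λ)` (`C¹` since `Λ` is continuous) turns
  `P = w F` into a subsolution `∂ₜP ≤ ΔP − v·∇P ≤ ΔP + (C/√(−t₁))(1 + ‖x‖)‖∇P‖`
  (Type-I bound `‖v‖ ≤ C/√(−t)`).
* `P` is bounded on the window (gauge bound `exists_gauge_norm_fderiv_le_of_typeI`,
  `‖ω‖ ≤ κ‖∇v‖`, `w` bounded on the compact window) and `P(t₀, ·) = F(t₀, ·) ≤ A²`; the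
  whole-space weak maximum principle `le_of_subsolution_linear_drift` gives `P ≤ A²` on the
  window, i.e. `‖ω(t₁, x)‖² ≤ A² exp(2∫Λ)`.

## References

* P. Constantin, Comm. Math. Phys. 129 (1990) 241–266, (2.9). [Constantin1990]
* G. M. Lieberman, *Second order parabolic differential equations* (1996), Ch. II. [Lieberman1996]
-/

noncomputable section

-- the sub-problem namespace repeats the summit name (D-0017 layout `Summit.<S>.<P>.Theorems`)
set_option linter.dupNamespace false

namespace Summit.NavierStokesRegularity.NavierStokesRegularity.Theorems

open MeasureTheory Set Function Filter Topology TopologicalSpace Metric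
open Literature.Analysis Literature.Analysis.FluidPDE
open scoped NNReal ENNReal RealInnerProductSpace Laplacian

/-- The squared vorticity `(t, x) ↦ ‖curl v(t)(x)‖²` of a jointly smooth field on `t < 0` is
jointly smooth there. [folklore] -/
theorem isSmoothSpaceTimeOn_norm_curl_sq
    {v : ℝ → EuclideanSpace ℝ (Fin 3) → EuclideanSpace ℝ (Fin 3)}
    (hsm : IsSmoothSpaceTimeOn (Iio 0) v) :
    IsSmoothSpaceTimeOn (Iio 0) fun s y => ‖curl (v s) y‖ ^ 2 := by
  have hvort : IsSmoothSpaceTimeOn (Iio 0) (vorticity v) := isSmoothSpaceTimeOn_vorticity_Iio hsm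
  have h1 : ContDiffOn ℝ (⊤ : ℕ∞)
      (fun p : ℝ × EuclideanSpace ℝ (Fin 3) => ‖uncurry (vorticity v) p‖ ^ 2) (Iio 0 ×ˢ univ) :=
    hvort.norm_sq ℝ
  refine h1.congr ?_
  rintro ⟨t, y⟩ -
  rfl

/-- **Kato's inequality for the squared vorticity with a strain majorant.** For `v ∈ A_C`,
`s < 0`, and a real `L` with `⟪∇v(s, y)ξ, ξ⟫ ≤ L‖ξ‖²` for all `ξ`, the smooth function
`F = ‖curl v‖²` satisfies `∂ₜF + v·∇F − ΔF ≤ 2L F` at `(s, y)`: where `ω ≠ 0` this is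
`stretchCert_F_subsolution` with the constant certificate `h ≡ 1` and `δ = 1 − (−s)L`; where
`ω = 0` the nonnegative `F` has a space–time minimum. [cite: Constantin1990, (2.9)] -/
theorem clockWindow_F_subsolution {C : ℝ}
    {v : ℝ → EuclideanSpace ℝ (Fin 3) → EuclideanSpace ℝ (Fin 3)}
    (hv : IsTypeIAncientMild C v) {s L : ℝ} (hs : s < 0) (y : EuclideanSpace ℝ (Fin 3))
    (hL : ∀ ξ : EuclideanSpace ℝ (Fin 3), ⟪fderiv ℝ (v s) y ξ, ξ⟫ ≤ L * ‖ξ‖ ^ 2) :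
    deriv (fun r => ‖curl (v r) y‖ ^ 2) s
        + fderiv ℝ (fun z => ‖curl (v s) z‖ ^ 2) y (v s y)
        - (Δ fun z => ‖curl (v s) z‖ ^ 2) y ≤ 2 * L * ‖curl (v s) y‖ ^ 2 := by
  have hsm : IsSmoothSpaceTimeOn (Iio 0) v := hv.contDiffOn
  have hs0 : 0 < -s := neg_pos.2 hs
  have hs1 : s ≠ 0 := hs.ne
  have hs' : s ∈ Iio (0 : ℝ) := hs
  set F : ℝ → EuclideanSpace ℝ (Fin 3) → ℝ := fun r z => ‖curl (v r) z‖ ^ 2 with hFdef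
  have hFsm : IsSmoothSpaceTimeOn (Iio 0) F := isSmoothSpaceTimeOn_norm_curl_sq hsm
  have hF2 : ContDiff ℝ 2 (F s) := (hFsm.contDiff_slice hs').of_le (by norm_cast)
  show deriv (fun r => F r y) s + fderiv ℝ (F s) y (v s y) - (Δ (F s)) y ≤ 2 * L * F s y
  by_cases hω : curl (v s) y = 0
  · -- a zero of the vorticity is a space–time minimum of `F ≥ 0`
    have hF0 : F s y = 0 := by simp [hFdef, hω]
    have hFnn : ∀ r z, 0 ≤ F r z := fun r z => sq_nonneg _
    have hminx : IsLocalMin (F s) y :=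
      Filter.Eventually.of_forall fun z => by rw [hF0]; exact hFnn s z
    have hmint : IsLocalMin (fun r => F r y) s :=
      Filter.Eventually.of_forall fun r => by
        show F s y ≤ F r y
        rw [hF0]
        exact hFnn r y
    have hD : fderiv ℝ (F s) y = 0 := hminx.fderiv_eq_zero
    have hdt : deriv (fun r => F r y) s = 0 := hmint.deriv_eq_zero
    have hΔ : 0 ≤ (Δ (F s)) y := by
      have h1 : (Δ (fun z => -F s z)) y ≤ 0 := IsLocalMax.laplacian_nonpos hF2.neg hminx.neg
      have e : (fun z => -F s z) = -(F s) := rfl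
      rw [e, InnerProductSpace.laplacian_neg, Pi.neg_apply, neg_nonpos] at h1
      exact h1
    rw [hdt, hD, hF0, zero_apply, mul_zero]
    linarith
  · -- Kato's inequality with the constant certificate `h ≡ 1`
    set h1 : ℝ → EuclideanSpace ℝ (Fin 3) → ℝ := fun _ _ => 1 with h1def
    have hh : IsSmoothSpaceTimeOn (Iio 0) h1 := contDiffOn_const
    have hh1 : ∀ t < (0 : ℝ), ∀ z, 1 ≤ h1 t z := fun _ _ _ => le_rfl
    have hveq := vorticity_eq_deriv_of_typeI hv hs y
    have hξ1 : ‖vorticityDirection (curl (v s)) y‖ = 1 := norm_vorticityDirection _ hω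
    have hσ : ⟪fderiv ℝ (v s) y (vorticityDirection (curl (v s)) y),
        vorticityDirection (curl (v s)) y⟫ ≤ L := by
      have := hL (vorticityDirection (curl (v s)) y)
      rwa [hξ1, one_pow, mul_one] at this
    have hΞ : 0 ≤ frobeniusNormSq (fderiv ℝ (vorticityDirection (curl (v s))) y) :=
      frobeniusNormSq_nonneg _
    have hcert : ((-s) * (⟪fderiv ℝ (v s) y (vorticityDirection (curl (v s)) y),
          vorticityDirection (curl (v s)) y⟫
          - frobeniusNormSq (fderiv ℝ (vorticityDirection (curl (v s))) y)) - 1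
          + (1 - (-s) * L)) * h1 s y ≤
        (-s) * (timeDeriv h1 s y + fderiv ℝ (h1 s) y (v s y) - (Δ (h1 s)) y) := by
      have e1 : timeDeriv h1 s y = 0 := by simp [timeDeriv_apply, h1def]
      have e2 : fderiv ℝ (h1 s) y = 0 := by simp [h1def]
      have e3 : (Δ (h1 s)) y = 0 := by simp [h1def]
      have e4 : h1 s y = 1 := rfl
      rw [e1, e2, e3, e4, zero_apply]
      nlinarith [mul_le_mul_of_nonneg_left hσ hs0.le, mul_nonneg hs0.le hΞ]
    have key := stretchCert_F_subsolution hsm hh hh1 (δ := 1 - (-s) * L) hs hω hveq hcert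
    simp only [h1def, one_pow, div_one, inv_one, fderiv_fun_const, Pi.zero_apply,
      zero_apply, mul_zero, Finset.sum_const_zero, add_zero] at key
    rw [show 2 * (1 - (1 - -s * L)) / -s = 2 * L by field_simp; ring] at key
    exact key

/-- **Constantin's stretching inequality on a window, Type-I ancient mild class** (crux
`RecurrentLiouville`, line `Sketch`, stub `stub_clockConstantinWindow`).  For `v ∈ A_C`
(`IsTypeIAncientMild C v`), a window `t₀ < t₁ < 0` and a continuous `Λ : ℝ → ℝ` majorising the
strain form on the window (`⟪∇v(t,x)ξ, ξ⟫ ≤ Λ(t)‖ξ‖²`), every bound `‖ω(t₀, ·)‖ ≤ A` of the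
vorticity `ω = curl v` propagates as `‖ω(t₁, x)‖ ≤ A exp(∫_{t₀}^{t₁} Λ)`.  Kato for the square
(`clockWindow_F_subsolution`: `∂ₜF + v·∇F − ΔF ≤ 2Λ F` for `F = ‖ω‖²`), the `C¹` weight
`w = exp(−2∫_{t₀}^{t}Λ)` (`P = wF` satisfies `∂ₜP ≤ ΔP + (C/√(−t₁))(1 + ‖x‖)‖∇P‖`), the Type-I
gauge bound (`P` bounded on the window) and the whole-space weak maximum principle
`le_of_subsolution_linear_drift` (`P(t₁, x) ≤ sup P(t₀, ·) ≤ A²`).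
[cite: Lieberman1996, Ch. II Lemma 2.1 and Thm. 2.4] -/
theorem stub_clockConstantinWindow :
    ∀ (C : ℝ) (v : ℝ → EuclideanSpace ℝ (Fin 3) → EuclideanSpace ℝ (Fin 3)),
      IsTypeIAncientMild C v →
      ∀ (t₀ t₁ : ℝ), t₀ < t₁ → t₁ < 0 →
      ∀ (Λ : ℝ → ℝ), Continuous Λ →
        (∀ t ∈ Set.Icc t₀ t₁, ∀ (x ξ : EuclideanSpace ℝ (Fin 3)),
          ⟪fderiv ℝ (v t) x ξ, ξ⟫ ≤ Λ t * ‖ξ‖ ^ 2) →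
        ∀ (A : ℝ), (∀ y, ‖curl (v t₀) y‖ ≤ A) →
          ∀ x, ‖curl (v t₁) x‖ ≤ A * Real.exp (∫ t in t₀..t₁, Λ t) := by
  intro C v hv t₀ t₁ h01 ht₁ Λ hΛ hstrain A hA x
  have hsm : IsSmoothSpaceTimeOn (Iio 0) v := hv.contDiffOn
  have hC0 : 0 ≤ C := hv.nonneg
  have ht₁0 : 0 < -t₁ := neg_pos.2 ht₁
  have hA0 : 0 ≤ A := (norm_nonneg _).trans (hA 0)
  have hIcc : Icc t₀ t₁ ⊆ Iio 0 := fun s hs => lt_of_le_of_lt hs.2 ht₁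
  -- the squared vorticity and the weight
  set F : ℝ → EuclideanSpace ℝ (Fin 3) → ℝ := fun s y => ‖curl (v s) y‖ ^ 2 with hFdef
  have hFsm : IsSmoothSpaceTimeOn (Iio 0) F := isSmoothSpaceTimeOn_norm_curl_sq hsm
  have hFnn : ∀ s y, 0 ≤ F s y := fun s y => sq_nonneg _
  set w : ℝ → ℝ := fun s => Real.exp (-2 * ∫ r in t₀..s, Λ r) with hwdef
  have hwpos : ∀ s, 0 < w s := fun s => Real.exp_pos _
  have hId : ∀ s, HasDerivAt (fun u => ∫ r in t₀..u, Λ r) (Λ s) s := fun s =>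
    (hΛ.integral_hasStrictDerivAt t₀ s).hasDerivAt
  have hwd : ∀ s, HasDerivAt w (w s * (-2 * Λ s)) s := fun s => ((hId s).const_mul (-2)).exp
  have hwc : Continuous w := by
    have h1 : Continuous fun u => ∫ r in t₀..u, Λ r :=
      continuous_iff_continuousAt.2 fun s => (hId s).continuousAt
    exact Real.continuous_exp.comp (continuous_const.mul h1)
  set P : ℝ → EuclideanSpace ℝ (Fin 3) → ℝ := fun s y => w s * F s y with hPdef
  set Pₜ : ℝ → EuclideanSpace ℝ (Fin 3) → ℝ :=
    fun s y => w s * (-2 * Λ s) * F s y + w s * deriv (fun r => F r y) s with hPₜdef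
  -- the Type-I bounds
  obtain ⟨K₀, hK₀⟩ := exists_gauge_norm_fderiv_le_of_typeI C
  have hK₀v : ∀ s < 0, ∀ y, (-s) * ‖fderiv ℝ (v s) y‖ ≤ K₀ := hK₀ hv
  obtain ⟨W, hW⟩ := isCompact_Icc.exists_bound_of_continuousOn
    (hwc.continuousOn (s := Icc t₀ t₁))
  set K : ℝ := C / Real.sqrt (-t₁) with hK
  have hK0 : 0 ≤ K := by positivity
  set B : ℝ := W * (‖curlCLM‖ * K₀ / (-t₁)) ^ 2 with hB
  -- (a) joint continuity on the window
  have hc : ContinuousOn (uncurry P) (Icc t₀ t₁ ×ˢ univ) := by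
    have h1 : ContinuousOn (fun p : ℝ × EuclideanSpace ℝ (Fin 3) => w p.1) (Icc t₀ t₁ ×ˢ univ) :=
      (hwc.comp continuous_fst).continuousOn
    have h2 : ContinuousOn (uncurry F) (Icc t₀ t₁ ×ˢ univ) :=
      hFsm.continuousOn.mono (prod_mono hIcc Subset.rfl)
    exact (h1.mul h2).congr fun p _ => rfl
  -- (b) `C²` slices
  have h2 : ∀ s ∈ Ioc t₀ t₁, ContDiff ℝ 2 (P s) := fun s hs =>
    contDiff_const.mul ((hFsm.contDiff_slice (hIcc ⟨hs.1.le, hs.2⟩)).of_le (by norm_cast))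
  -- (c) the time derivative
  have ht : ∀ s ∈ Ioc t₀ t₁, ∀ y, HasDerivAt (fun r => P r y) (Pₜ s y) s := fun s hs y =>
    (hwd s).mul (hFsm.hasDerivAt_timeLine isOpen_Iio (hIcc ⟨hs.1.le, hs.2⟩) y)
  -- (d) the subsolution inequality
  have hsub : ∀ s ∈ Ioc t₀ t₁, ∀ y,
      Pₜ s y ≤ (Δ (P s)) y + K * (1 + ‖y‖) * ‖fderiv ℝ (P s) y‖ := by
    intro s hs y
    have hsI : s ∈ Icc t₀ t₁ := ⟨hs.1.le, hs.2⟩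
    have hs0 : s < 0 := hIcc hsI
    have hF2 : ContDiff ℝ 2 (F s) := (hFsm.contDiff_slice (hIcc hsI)).of_le (by norm_cast)
    have hFd : DifferentiableAt ℝ (F s) y := (hF2.differentiable two_ne_zero) y
    -- Kato for the square
    have key : deriv (fun r => F r y) s + fderiv ℝ (F s) y (v s y) - (Δ (F s)) y ≤
        2 * Λ s * F s y :=
      clockWindow_F_subsolution hv hs0 y (hstrain s hsI y)
    -- spatial derivatives of the slice `P s = w s • F s`
    have hDP : fderiv ℝ (P s) y = w s • fderiv ℝ (F s) y := fderiv_const_mul hFd (w s)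
    have hΔP : (Δ (P s)) y = w s * (Δ (F s)) y := by
      have hPs : P s = w s • F s := rfl
      rw [hPs, InnerProductSpace.laplacian_smul (w s) hF2.contDiffAt]
      rfl
    have hDPv : fderiv ℝ (P s) y (v s y) = w s * fderiv ℝ (F s) y (v s y) := by
      rw [hDP]
      rfl
    -- the transport term and the Type-I bound
    have h1 : -(fderiv ℝ (P s) y (v s y)) ≤ ‖fderiv ℝ (P s) y‖ * (C / Real.sqrt (-s)) := by
      have a1 : |fderiv ℝ (P s) y (v s y)| ≤ ‖fderiv ℝ (P s) y‖ * ‖v s y‖ := by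
        rw [← Real.norm_eq_abs]; exact (fderiv ℝ (P s) y).le_opNorm (v s y)
      have a2 : ‖fderiv ℝ (P s) y‖ * ‖v s y‖ ≤ ‖fderiv ℝ (P s) y‖ * (C / Real.sqrt (-s)) :=
        mul_le_mul_of_nonneg_left (hv.norm_le hs0 y) (norm_nonneg _)
      linarith [neg_abs_le (fderiv ℝ (P s) y (v s y))]
    have hcoef : C / Real.sqrt (-s) ≤ K * (1 + ‖y‖) := by
      have hst : -t₁ ≤ -s := by linarith [hs.2]
      have hsqt : 0 < Real.sqrt (-t₁) := Real.sqrt_pos.2 ht₁0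
      have i1 : C / Real.sqrt (-s) ≤ K :=
        div_le_div_of_nonneg_left hC0 hsqt (Real.sqrt_le_sqrt hst)
      have i2 : K ≤ K * (1 + ‖y‖) :=
        le_mul_of_one_le_right hK0 (by linarith [norm_nonneg y])
      exact i1.trans i2
    have h3 := mul_le_mul_of_nonneg_left hcoef (norm_nonneg (fderiv ℝ (P s) y))
    have k2 := mul_le_mul_of_nonneg_left key (hwpos s).le
    show w s * (-2 * Λ s) * F s y + w s * deriv (fun r => F r y) s ≤
      (Δ (P s)) y + K * (1 + ‖y‖) * ‖fderiv ℝ (P s) y‖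
    rw [hΔP]
    nlinarith [k2, h1, h3, hDPv]
  -- (e) the upper bound on the window
  have hBnd : ∀ s ∈ Icc t₀ t₁, ∀ y, P s y ≤ B := by
    intro s hs y
    have hs0 : s < 0 := hIcc hs
    have hms : 0 < -s := neg_pos.2 hs0
    have hwW : w s ≤ W := by
      have := hW s hs
      rwa [Real.norm_eq_abs, abs_of_pos (hwpos s)] at this
    have hW0 : 0 ≤ W := (norm_nonneg _).trans (hW s hs)
    have h1 : (-t₁) * ‖curl (v s) y‖ ≤ ‖curlCLM‖ * K₀ := by
      calc (-t₁) * ‖curl (v s) y‖ ≤ (-s) * ‖curl (v s) y‖ :=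
            mul_le_mul_of_nonneg_right (by linarith [hs.2]) (norm_nonneg _)
        _ ≤ (-s) * (‖curlCLM‖ * ‖fderiv ℝ (v s) y‖) :=
            mul_le_mul_of_nonneg_left (norm_curl_le (v s) y) hms.le
        _ = ‖curlCLM‖ * ((-s) * ‖fderiv ℝ (v s) y‖) := by ring
        _ ≤ ‖curlCLM‖ * K₀ := mul_le_mul_of_nonneg_left (hK₀v s hs0 y) (norm_nonneg curlCLM)
    have h2 : ‖curl (v s) y‖ ≤ ‖curlCLM‖ * K₀ / (-t₁) := by
      rw [le_div_iff₀ ht₁0]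
      linarith
    have h3 : F s y ≤ (‖curlCLM‖ * K₀ / (-t₁)) ^ 2 := pow_le_pow_left₀ (norm_nonneg _) h2 2
    calc P s y = w s * F s y := rfl
      _ ≤ W * (‖curlCLM‖ * K₀ / (-t₁)) ^ 2 := mul_le_mul hwW h3 (hFnn s y) hW0
  -- (f) the initial bound
  have hM : ∀ y, P t₀ y ≤ A ^ 2 := by
    intro y
    have hw0 : w t₀ = 1 := by simp [hwdef]
    calc P t₀ y = w t₀ * F t₀ y := rfl
      _ = ‖curl (v t₀) y‖ ^ 2 := by rw [hw0, one_mul]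
      _ ≤ A ^ 2 := pow_le_pow_left₀ (norm_nonneg _) (hA y) 2
  -- the weak maximum principle on `[t₀, t₁] × ℝ³`
  have hmp := le_of_subsolution_linear_drift hK0 hc h2 ht hsub hBnd hM t₁ ⟨h01.le, le_rfl⟩ x
  -- conclude
  set I : ℝ := ∫ t in t₀..t₁, Λ t with hI
  have hPt₁ : P t₁ x = Real.exp (-2 * I) * ‖curl (v t₁) x‖ ^ 2 := rfl
  rw [hPt₁] at hmp
  have hsq : ‖curl (v t₁) x‖ ^ 2 ≤ (A * Real.exp I) ^ 2 := by
    have e1 : (A * Real.exp I) ^ 2 = A ^ 2 * Real.exp (2 * I) := by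
      rw [mul_pow, sq (Real.exp I), ← Real.exp_add, two_mul]
    have e2 : Real.exp (2 * I) * (Real.exp (-2 * I) * ‖curl (v t₁) x‖ ^ 2) =
        ‖curl (v t₁) x‖ ^ 2 := by
      rw [← mul_assoc, ← Real.exp_add, show 2 * I + -2 * I = 0 by ring, Real.exp_zero, one_mul]
    have e3 := mul_le_mul_of_nonneg_left hmp (Real.exp_pos (2 * I)).le
    rw [e2] at e3
    rw [e1]
    linarith
  have hAe : 0 ≤ A * Real.exp I := mul_nonneg hA0 (Real.exp_pos I).le
  exact (pow_le_pow_iff_left₀ (norm_nonneg _) hAe two_ne_zero).1 hsq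

end Summit.NavierStokesRegularity.NavierStokesRegularity.Theorems

end
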